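import Summits.KontsevichZagierPeriods.KontsevichZagierPeriods.Theorems.SymplecticScissorsRealOnePeriodRelationsIsoLayer
import Summits.KontsevichZagierPeriods.KontsevichZagierPeriods.Theorems.SymplecticScissorsRealOnePeriodRelationsLoopLayerModels
import Summits.KontsevichZagierPeriods.KontsevichZagierPeriods.Theorems.SymplecticScissorsRealOnePeriodRelationsStubQuarticTailCell

/-!
# `RealOnePeriodRelations` (stmt-KontsevichZagierPeriods-10042), line `nash-retraction-thin-strip`, reshape 7b:
# convergent first-kind QUARTIC TAILS on the isogeny-class layer, unconditionally

A convergent tail `∫_{M₀}^∞ c₀ dx/√q` of a real quartic `q = a₄x⁴ + a₃x³ + a₂x² + a₁x + a₀` over `ℚ̄ ∩ ℝ` beyond a real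
root `ε` (`q > 0` on `(ε, ∞)`, `q′(ε) > 0`, `M₀ > ε` algebraic) is, by the Möbius chart `v = q′(ε)/(x − ε)` (the landed stub
`QuarticLayer.stub_quarticTailCell`, p141694), an INCOMPLETE first-kind integral `∫ c₀ dv/√D` of the monic resolvent cubic
`D(v) = v³ + b₂v² + b₁v + b₀` over the bounded cell `(0, q′(ε)/(M₀ − ε))`, and by one more rule-2 translation `u = v + b₂/3`
(`shift_cell`, from `LoopLayer.exists_shift`) an incomplete first-kind integral on the depressed Weierstrass cubic
`u³ + A′u + B′`.  Hence the landed ISOGENY-CLASS LAYER `IsoLayer.realOnePeriodRelations_isoLayer` (Huber–Wüstholz 13.3 (2)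
for arbitrary paths on all real Weierstrass curves isogenous into one curve without complex multiplication — PROVED in the
tree) absorbs quartic tails whose depressed resolvent cubic belongs to the family:

* `shift_cell` — translation of a bounded first-kind cell of a monic cubic to its depressed form (rule 2);
* `realOnePeriodRelations_quarticTailIsoLayer` — every `ℤ`-combination with vanishing value of rational representations,
  first/second-kind cells and first-kind tails of a family of real Weierstrass curves `y² = x³ + A_j x + B_j` isogenous
  into one non-CM curve, AND convergent first-kind tails of real quartics whose depressed resolvent cubic is one of the
  `x³ + A_j x + B_j`, lies in `M₁ = closure (1a ∪ 1b ∪ 2 ∪ Green)` — unconditionally.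

References: A. Huber, G. Wüstholz, *Transcendence and Linear Relations of 1-Periods* (CUP 2022), Thm 13.3 (2), §13.2,
Ch. 15; M. Kontsevich, D. Zagier, *Periods* (2001), §1.2 (rule 2).
-/

noncomputable section

open scoped BigOperators Polynomial
open Set MeasureTheory
open Literature.NumberTheory.Transcendental
open Summit.KontsevichZagierPeriods.SymplecticScissors.RealOnePeriodRelationsNegative (M₁ H₁)

namespace Summit.KontsevichZagierPeriods.SymplecticScissors.RealOnePeriodRelations

namespace QuarticLayer

/-- **Translation of a bounded first-kind cell of a monic cubic to its depressed form** (rule 2 along `u = v + a₂/3`,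
`LoopLayer.exists_shift` + `LoopLayer.depress_identity`): a representation on `{z | z 0 ∈ (v₁, v₂)}` with integrand
`c₀/√(v³ + a₂v² + a₁v + a₀)` (the cubic positive on the cell) differs by an element of `M₁` from a representation on the
shifted cell with integrand `c₀/√(u³ + A′u + B′)`, `A′ = a₁ − a₂²/3`, `B′ = a₀ − a₁a₂/3 + 2a₂³/27`.
[cite: KontsevichZagier2001, §1.2 (rule 2)] -/
theorem shift_cell (a₂ a₁ a₀ : ℝ) (ha₂ : IsAlgebraic ℚ a₂) {v₁ v₂ c₀ : ℝ}
    (hpos : ∀ x ∈ Set.Ioo v₁ v₂, 0 < x ^ 3 + a₂ * x ^ 2 + a₁ * x + a₀)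
    (r : KZ.IntegralRep 1) (hdom : r.domain = {z | z 0 ∈ Set.Ioo v₁ v₂})
    (hint : ∀ z ∈ r.domain, r.integrand z = c₀ / Real.sqrt ((z 0) ^ 3 + a₂ * (z 0) ^ 2 + a₁ * (z 0) + a₀)) :
    ∃ ρ : KZ.IntegralRep 1, ρ.domain = {z | z 0 ∈ Set.Ioo (v₁ + a₂ / 3) (v₂ + a₂ / 3)} ∧
      (∀ x ∈ Set.Ioo (v₁ + a₂ / 3) (v₂ + a₂ / 3),
        0 < x ^ 3 + (a₁ - a₂ ^ 2 / 3) * x + (a₀ - a₁ * a₂ / 3 + 2 * a₂ ^ 3 / 27)) ∧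
      (∀ x ∈ Set.Ioo (v₁ + a₂ / 3) (v₂ + a₂ / 3), ρ.integrand (fun _ => x) =
        c₀ / Real.sqrt (x ^ 3 + (a₁ - a₂ ^ 2 / 3) * x + (a₀ - a₁ * a₂ / 3 + 2 * a₂ ^ 3 / 27))) ∧
      KZ.of r - KZ.of ρ ∈ M₁ := by
  set σ : ℝ := a₂ / 3 with hσ
  have hσalg : IsAlgebraic ℚ σ := by rw [hσ, div_eq_mul_inv]; exact ha₂.mul (isAlgebraic_nat 3).inv
  have hident : ∀ u : ℝ, (u - σ) ^ 3 + a₂ * (u - σ) ^ 2 + a₁ * (u - σ) + a₀ =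
      u ^ 3 + (a₁ - a₂ ^ 2 / 3) * u + (a₀ - a₁ * a₂ / 3 + 2 * a₂ ^ 3 / 27) :=
    fun u => LoopLayer.depress_identity a₂ a₁ a₀ u
  have hmemr : ∀ p : Fin 1 → ℝ, p ∈ r.domain ↔ p 0 ∈ Set.Ioo v₁ v₂ := fun p => by rw [hdom]; rfl
  obtain ⟨s, hs, hsi, hrel⟩ := LoopLayer.exists_shift r σ hσalg
  have hsdom : s.domain = {z | z 0 ∈ Set.Ioo (v₁ + σ) (v₂ + σ)} := by
    rw [hs]
    ext z
    constructor
    · rintro ⟨p, hp, rfl⟩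
      have hp' := (hmemr p).1 hp
      show p 0 + σ ∈ Set.Ioo (v₁ + σ) (v₂ + σ)
      exact ⟨by linarith [hp'.1], by linarith [hp'.2]⟩
    · intro hz
      have hz' : z 0 ∈ Set.Ioo (v₁ + σ) (v₂ + σ) := hz
      refine ⟨fun _ => z 0 - σ, (hmemr _).2 ⟨by show v₁ < z 0 - σ; linarith [hz'.1],
        by show z 0 - σ < v₂; linarith [hz'.2]⟩, ?_⟩
      rw [KZ.eq_const_apply_zero z]
      funext
      simp
  refine ⟨s, hsdom, fun x hx => ?_, fun x hx => ?_, hrel⟩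
  · rw [← hident]
    exact hpos _ ⟨by linarith [hx.1], by linarith [hx.2]⟩
  · have hx' : x - σ ∈ Set.Ioo v₁ v₂ := ⟨by linarith [hx.1], by linarith [hx.2]⟩
    have h := hsi (fun _ => x - σ) ((hmemr _).2 hx')
    simp only [sub_add_cancel] at h
    rw [h, hint _ ((hmemr _).2 hx')]
    show c₀ / Real.sqrt ((x - σ) ^ 3 + a₂ * (x - σ) ^ 2 + a₁ * (x - σ) + a₀) = _
    rw [hident]

/-- **CONVERGENT FIRST-KIND QUARTIC TAILS ON THE ISOGENY-CLASS LAYER, UNCONDITIONALLY.**  Let `E_j : y² = x³ + A_j x + B_j`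
(`j ∈ ι`, `A_j, B_j` real algebraic) be real Weierstrass curves whose lattices `L_j` map by algebraic isogenies `z ↦ α_j z` into
ONE lattice `M` without complex multiplication, and let `q_k = a₄x⁴ + a₃x³ + a₂x² + a₁x + a₀` (`k < m`) be real quartics over
`ℚ̄ ∩ ℝ` with a marked real root `ε_k`, `q_k > 0` on `(ε_k, ∞)`, `q_k′(ε_k) > 0`, whose DEPRESSED RESOLVENT CUBIC at `ε_k` is
`x³ + A_{j(k)} x + B_{j(k)}` (hypotheses `hA`, `hB`: the coefficients `b₁ − b₂²/3`, `b₀ − b₁b₂/3 + 2b₂³/27` of the depressed form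
of `D_k = v³ + b₂v² + b₁v + b₀`, `b₂ = 6a₄ε² + 3a₃ε + a₂`, `b₁ = (4a₄ε + a₃)q′(ε)`, `b₀ = a₄q′(ε)²`).  Every `ℤ`-combination with
vanishing value of rational representations, first/second-kind real abelian integrals and convergent first-kind tails on the
`E_j` (as in `IsoLayer.realOnePeriodRelations_isoLayer`) and convergent first-kind tails `∫_{M₀}^∞ c₀ dx/√q_k` (`M₀ > ε_k`,
`M₀, c₀` real algebraic) lies in `M₁ = closure (1a ∪ 1b ∪ 2 ∪ Green)`.  Proof: `stub_quarticTailCell` (Möbius chart, rule 2),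
`shift_cell` (translation, rule 2) and `IsoLayer.realOnePeriodRelations_isoLayer`.
[cite: HuberWustholz2022, Thm 13.3 (2), §13.2, Ch. 15] [cite: KontsevichZagier2001, §1.2 (rule 2)] -/
theorem realOnePeriodRelations_quarticTailIsoLayer : ∀ {ι : Type} (A B : ι → ℝ), (∀ j, IsAlgebraic ℚ (A j)) →
    (∀ j, IsAlgebraic ℚ (B j)) → ∀ (M : PeriodPair), IsAlgebraic ℚ M.g₂ → IsAlgebraic ℚ M.g₃ → ¬ M.HasCM →
    ∀ (L : ι → PeriodPair) (α : ι → ℂ), (∀ j, (L j).g₂ = -4 * (A j : ℂ)) → (∀ j, (L j).g₃ = -4 * (B j : ℂ)) →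
    (∀ j, α j ≠ 0) → (∀ j, IsAlgebraic ℚ (α j)) → (∀ j, ∀ l ∈ (L j).lattice, α j * l ∈ M.lattice) →
    ∀ (m : ℕ) (a₄ a₃ a₂ a₁ a₀ ε : Fin m → ℝ) (jq : Fin m → ι),
    (∀ k, IsAlgebraic ℚ (a₄ k)) → (∀ k, IsAlgebraic ℚ (a₃ k)) → (∀ k, IsAlgebraic ℚ (a₂ k)) →
    (∀ k, IsAlgebraic ℚ (a₁ k)) → (∀ k, IsAlgebraic ℚ (a₀ k)) → (∀ k, IsAlgebraic ℚ (ε k)) →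
    (∀ k, a₄ k * ε k ^ 4 + a₃ k * ε k ^ 3 + a₂ k * ε k ^ 2 + a₁ k * ε k + a₀ k = 0) →
    (∀ k, ∀ x : ℝ, ε k < x → 0 < a₄ k * x ^ 4 + a₃ k * x ^ 3 + a₂ k * x ^ 2 + a₁ k * x + a₀ k) →
    (∀ k, 0 < 4 * a₄ k * ε k ^ 3 + 3 * a₃ k * ε k ^ 2 + 2 * a₂ k * ε k + a₁ k) →
    (∀ k, A (jq k) = (4 * a₄ k * ε k + a₃ k) * (4 * a₄ k * ε k ^ 3 + 3 * a₃ k * ε k ^ 2 + 2 * a₂ k * ε k + a₁ k) -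
      (6 * a₄ k * ε k ^ 2 + 3 * a₃ k * ε k + a₂ k) ^ 2 / 3) →
    (∀ k, B (jq k) = a₄ k * (4 * a₄ k * ε k ^ 3 + 3 * a₃ k * ε k ^ 2 + 2 * a₂ k * ε k + a₁ k) ^ 2 -
      (4 * a₄ k * ε k + a₃ k) * (4 * a₄ k * ε k ^ 3 + 3 * a₃ k * ε k ^ 2 + 2 * a₂ k * ε k + a₁ k) *
        (6 * a₄ k * ε k ^ 2 + 3 * a₃ k * ε k + a₂ k) / 3 + 2 * (6 * a₄ k * ε k ^ 2 + 3 * a₃ k * ε k + a₂ k) ^ 3 / 27) →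
    ∀ c : KZ.FormalRep, c ∈ AddSubgroup.closure ((fun r : KZ.IntegralRep 1 => KZ.of r) ''
      {r | r.IsRational ∨
        (∃ j, ∃ a b : ℝ, IsAlgebraic ℚ a ∧ IsAlgebraic ℚ b ∧ a < b ∧ r.domain = {z | z 0 ∈ Set.Ioo a b} ∧
          (∀ x ∈ Set.Ioo a b, 0 < x ^ 3 + A j * x + B j) ∧
          ∃ P₁ P₂ P₃ : Polynomial (algebraicClosure ℚ ℝ), ∀ x ∈ Set.Ioo a b,
            r.integrand (fun _ => x) = Polynomial.aeval x P₁ + Polynomial.aeval x P₂ * Real.sqrt (x ^ 3 + A j * x + B j) +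
              Polynomial.aeval x P₃ / Real.sqrt (x ^ 3 + A j * x + B j)) ∨
        (∃ j, ∃ e M c₀ : ℝ, IsAlgebraic ℚ e ∧ IsAlgebraic ℚ M ∧ IsAlgebraic ℚ c₀ ∧ e ^ 3 + A j * e + B j = 0 ∧
          0 < 3 * e ^ 2 + A j ∧ e < M ∧ (∀ x : ℝ, e < x → 0 < x ^ 3 + A j * x + B j) ∧ r.domain = {z | M < z 0} ∧
          ∀ z ∈ r.domain, r.integrand z = c₀ / Real.sqrt ((z 0) ^ 3 + A j * (z 0) + B j)) ∨
        (∃ k, ∃ M₀ c₀ : ℝ, IsAlgebraic ℚ M₀ ∧ IsAlgebraic ℚ c₀ ∧ ε k < M₀ ∧ r.domain = {z | M₀ < z 0} ∧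
          ∀ z ∈ r.domain, r.integrand z =
            c₀ / Real.sqrt (a₄ k * (z 0) ^ 4 + a₃ k * (z 0) ^ 3 + a₂ k * (z 0) ^ 2 + a₁ k * (z 0) + a₀ k))}) →
    KZ.eval c = 0 →
    c ∈ AddSubgroup.closure (KZ.domainAddRel ∪ KZ.integrandAddRel ∪ KZ.changeOfVariablesRel ∪
      {g : KZ.FormalRep | ∃ (Δ : Set (Fin 2 → ℝ)) (A B S : (Fin 2 → ℝ) → ℝ) (r₀₁ r₁₂ r₀₂ : KZ.IntegralRep 1),
        Δ = {p | 0 ≤ p 0 ∧ 0 ≤ p 1 ∧ p 0 + p 1 ≤ 1} ∧ IsSemialgebraicFunOn ℚ Δ A ∧ IsSemialgebraicFunOn ℚ Δ B ∧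
        ContinuousOn A Δ ∧ ContinuousOn B Δ ∧
        (∀ p : Fin 2 → ℝ, 0 < p 0 → 0 < p 1 → p 0 + p 1 < 1 →
          HasFDerivAt S (A p • ContinuousLinearMap.proj (R := ℝ) (φ := fun _ : Fin 2 => ℝ) 0 +
            B p • ContinuousLinearMap.proj (R := ℝ) (φ := fun _ : Fin 2 => ℝ) 1) p) ∧
        r₀₁.domain = {z | z 0 ∈ Set.Ioo 0 1} ∧ r₁₂.domain = {z | z 0 ∈ Set.Ioo 0 1} ∧
        r₀₂.domain = {z | z 0 ∈ Set.Ioo 0 1} ∧ (∀ z ∈ r₀₁.domain, r₀₁.integrand z = A ![z 0, 0]) ∧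
        (∀ z ∈ r₁₂.domain, r₁₂.integrand z = B ![1 - z 0, z 0] - A ![1 - z 0, z 0]) ∧
        (∀ z ∈ r₀₂.domain, r₀₂.integrand z = B ![0, z 0]) ∧ g = KZ.of r₀₁ + KZ.of r₁₂ - KZ.of r₀₂}) := by
  intro ι A B hA hB M hM₂ hM₃ hCM L α hL₂ hL₃ hα hαalg hαM m a₄ a₃ a₂ a₁ a₀ ε jq ha₄ ha₃ ha₂ ha₁ ha₀ hε hroot hposq hder
    hAq hBq c hc heval
  change c ∈ M₁
  -- Taylor coefficients of `q_k` at `ε_k`: the monic resolvent cubic `D_k = v³ + b₂ v² + b₁ v + b₀`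
  set c₃ : Fin m → ℝ := fun k => 4 * a₄ k * ε k ^ 3 + 3 * a₃ k * ε k ^ 2 + 2 * a₂ k * ε k + a₁ k with hc₃
  set b₂ : Fin m → ℝ := fun k => 6 * a₄ k * ε k ^ 2 + 3 * a₃ k * ε k + a₂ k with hb₂
  set b₁ : Fin m → ℝ := fun k => (4 * a₄ k * ε k + a₃ k) * c₃ k with hb₁
  set b₀ : Fin m → ℝ := fun k => a₄ k * c₃ k ^ 2 with hb₀
  have hb₂alg : ∀ k, IsAlgebraic ℚ (b₂ k) := fun k =>
    ((((isAlgebraic_nat 6).mul (ha₄ k)).mul ((hε k).pow 2)).add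
      (((isAlgebraic_nat 3).mul (ha₃ k)).mul (hε k))).add (ha₂ k)
  have hc₃alg : ∀ k, IsAlgebraic ℚ (c₃ k) := fun k =>
    (((((isAlgebraic_nat 4).mul (ha₄ k)).mul ((hε k).pow 3)).add
      (((isAlgebraic_nat 3).mul (ha₃ k)).mul ((hε k).pow 2))).add
      (((isAlgebraic_nat 2).mul (ha₂ k)).mul (hε k))).add (ha₁ k)
  have hA' : ∀ k, b₁ k - b₂ k ^ 2 / 3 = A (jq k) := fun k => by rw [hAq k]
  have hB' : ∀ k, b₀ k - b₁ k * b₂ k / 3 + 2 * b₂ k ^ 3 / 27 = B (jq k) := fun k => by rw [hBq k]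
  -- every generator is, modulo `M₁`, a generator of the isogeny-class layer
  have key : ∀ c : KZ.FormalRep, c ∈ AddSubgroup.closure ((fun r : KZ.IntegralRep 1 => KZ.of r) ''
      {r | r.IsRational ∨
        (∃ j, ∃ a b : ℝ, IsAlgebraic ℚ a ∧ IsAlgebraic ℚ b ∧ a < b ∧ r.domain = {z | z 0 ∈ Set.Ioo a b} ∧
          (∀ x ∈ Set.Ioo a b, 0 < x ^ 3 + A j * x + B j) ∧
          ∃ P₁ P₂ P₃ : Polynomial (algebraicClosure ℚ ℝ), ∀ x ∈ Set.Ioo a b,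
            r.integrand (fun _ => x) = Polynomial.aeval x P₁ + Polynomial.aeval x P₂ * Real.sqrt (x ^ 3 + A j * x + B j) +
              Polynomial.aeval x P₃ / Real.sqrt (x ^ 3 + A j * x + B j)) ∨
        (∃ j, ∃ e M c₀ : ℝ, IsAlgebraic ℚ e ∧ IsAlgebraic ℚ M ∧ IsAlgebraic ℚ c₀ ∧ e ^ 3 + A j * e + B j = 0 ∧
          0 < 3 * e ^ 2 + A j ∧ e < M ∧ (∀ x : ℝ, e < x → 0 < x ^ 3 + A j * x + B j) ∧ r.domain = {z | M < z 0} ∧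
          ∀ z ∈ r.domain, r.integrand z = c₀ / Real.sqrt ((z 0) ^ 3 + A j * (z 0) + B j)) ∨
        (∃ k, ∃ M₀ c₀ : ℝ, IsAlgebraic ℚ M₀ ∧ IsAlgebraic ℚ c₀ ∧ ε k < M₀ ∧ r.domain = {z | M₀ < z 0} ∧
          ∀ z ∈ r.domain, r.integrand z =
            c₀ / Real.sqrt (a₄ k * (z 0) ^ 4 + a₃ k * (z 0) ^ 3 + a₂ k * (z 0) ^ 2 + a₁ k * (z 0) + a₀ k))}) →
      ∃ c' : KZ.FormalRep, c' ∈ AddSubgroup.closure ((fun r : KZ.IntegralRep 1 => KZ.of r) ''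
      {r | r.IsRational ∨
        (∃ j, ∃ a b : ℝ, IsAlgebraic ℚ a ∧ IsAlgebraic ℚ b ∧ a < b ∧ r.domain = {z | z 0 ∈ Set.Ioo a b} ∧
          (∀ x ∈ Set.Ioo a b, 0 < x ^ 3 + A j * x + B j) ∧
          ∃ P₁ P₂ P₃ : Polynomial (algebraicClosure ℚ ℝ), ∀ x ∈ Set.Ioo a b,
            r.integrand (fun _ => x) = Polynomial.aeval x P₁ + Polynomial.aeval x P₂ * Real.sqrt (x ^ 3 + A j * x + B j) +
              Polynomial.aeval x P₃ / Real.sqrt (x ^ 3 + A j * x + B j)) ∨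
        (∃ j, ∃ e M c₀ : ℝ, IsAlgebraic ℚ e ∧ IsAlgebraic ℚ M ∧ IsAlgebraic ℚ c₀ ∧ e ^ 3 + A j * e + B j = 0 ∧
          0 < 3 * e ^ 2 + A j ∧ e < M ∧ (∀ x : ℝ, e < x → 0 < x ^ 3 + A j * x + B j) ∧ r.domain = {z | M < z 0} ∧
          ∀ z ∈ r.domain, r.integrand z = c₀ / Real.sqrt ((z 0) ^ 3 + A j * (z 0) + B j))}) ∧
      c - c' ∈ M₁ := by
    intro c hc
    refine AddSubgroup.closure_induction (p := fun c _ => ∃ c' : KZ.FormalRep, c' ∈ _ ∧ c - c' ∈ M₁) ?_ ?_ ?_ ?_ hc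
    · rintro _ ⟨r, hr, rfl⟩
      rcases hr with hrat | hcell | htail | ⟨k, M₀, c₀, hM₀, hc₀, hlt, hdom, hint⟩
      · exact ⟨KZ.of r, AddSubgroup.subset_closure ⟨r, Or.inl hrat, rfl⟩, by rw [sub_self]; exact M₁.zero_mem⟩
      · exact ⟨KZ.of r, AddSubgroup.subset_closure ⟨r, Or.inr (Or.inl hcell), rfl⟩, by rw [sub_self]; exact M₁.zero_mem⟩
      · exact ⟨KZ.of r, AddSubgroup.subset_closure ⟨r, Or.inr (Or.inr htail), rfl⟩, by rw [sub_self]; exact M₁.zero_mem⟩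
      · -- the Möbius chart: a bounded first-kind cell of the resolvent cubic `D_k`
        obtain ⟨r₁, hr₁dom, hr₁int, hr₁pos, hrel₁⟩ := stub_quarticTailCell (a₄ k) (a₃ k) (a₂ k) (a₁ k) (a₀ k) (ha₄ k)
          (ha₃ k) (ha₂ k) (ha₁ k) (ha₀ k) (ε k) M₀ c₀ (hε k) hM₀ hc₀ hlt (hroot k) (hposq k) (hder k) r hdom hint
        have hw : 0 < c₃ k / (M₀ - ε k) := div_pos (hder k) (sub_pos.2 hlt)
        -- the translation to the depressed cubic `x³ + A_{j k} x + B_{j k}`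
        have hposD : ∀ x ∈ Set.Ioo 0 (c₃ k / (M₀ - ε k)), 0 < x ^ 3 + b₂ k * x ^ 2 + b₁ k * x + b₀ k := by
          intro x hx
          simpa only [hc₃, hb₂, hb₁, hb₀] using hr₁pos x (by simpa only [hc₃] using hx)
        have hr₁dom' : r₁.domain = {z | z 0 ∈ Set.Ioo 0 (c₃ k / (M₀ - ε k))} := by
          simpa only [hc₃] using hr₁dom
        have hr₁int' : ∀ z ∈ r₁.domain, r₁.integrand z =
            c₀ / Real.sqrt ((z 0) ^ 3 + b₂ k * (z 0) ^ 2 + b₁ k * (z 0) + b₀ k) := by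
          intro z hz
          simpa only [hc₃, hb₂, hb₁, hb₀] using hr₁int z hz
        obtain ⟨ρ, hρdom, hρpos, hρint, hrel₂⟩ :=
          shift_cell (b₂ k) (b₁ k) (b₀ k) (hb₂alg k) hposD r₁ hr₁dom' hr₁int'
        have hc₀' : c₀ ∈ algebraicClosure ℚ ℝ := mem_algebraicClosure_iff.mpr hc₀
        refine ⟨KZ.of ρ, AddSubgroup.subset_closure ⟨ρ, Or.inr (Or.inl ⟨jq k, 0 + b₂ k / 3,
          c₃ k / (M₀ - ε k) + b₂ k / 3, ?_, ?_, by linarith, hρdom, ?_, 0, 0, Polynomial.C ⟨c₀, hc₀'⟩, ?_⟩), rfl⟩, ?_⟩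
        · rw [zero_add, div_eq_mul_inv]
          exact (hb₂alg k).mul (isAlgebraic_nat 3).inv
        · rw [div_eq_mul_inv, div_eq_mul_inv]
          exact ((hc₃alg k).mul (hM₀.sub (hε k)).inv).add ((hb₂alg k).mul (isAlgebraic_nat 3).inv)
        · intro x hx
          rw [← hA' k, ← hB' k]
          exact hρpos x hx
        · intro x hx
          rw [hρint x hx, hA' k, hB' k]
          simp
        · have e : KZ.of r - KZ.of ρ = (KZ.of r - KZ.of r₁) + (KZ.of r₁ - KZ.of ρ) := by abel
          rw [e]
          exact M₁.add_mem hrel₁ hrel₂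
    · exact ⟨0, AddSubgroup.zero_mem _, by rw [sub_self]; exact M₁.zero_mem⟩
    · rintro c₁ c₂ _ _ ⟨c₁', h₁', h₁⟩ ⟨c₂', h₂', h₂⟩
      refine ⟨c₁' + c₂', AddSubgroup.add_mem _ h₁' h₂', ?_⟩
      have e : c₁ + c₂ - (c₁' + c₂') = (c₁ - c₁') + (c₂ - c₂') := by abel
      rw [e]
      exact M₁.add_mem h₁ h₂
    · rintro c₁ _ ⟨c₁', h₁', h₁⟩
      refine ⟨-c₁', AddSubgroup.neg_mem _ h₁', ?_⟩
      have e : -c₁ - -c₁' = -(c₁ - c₁') := by abel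
      rw [e]
      exact M₁.neg_mem h₁
  obtain ⟨c', hc', hcc'⟩ := key c hc
  have heval' : KZ.eval c' = 0 := by
    have h := Summit.KontsevichZagierPeriods.SymplecticScissors.RealOnePeriodRelationsNegative.eval_eq_zero_of_mem_M₁ hcc'
    rw [map_sub, heval, zero_sub, neg_eq_zero] at h
    exact h
  have hM : c' ∈ M₁ :=
    IsoLayer.realOnePeriodRelations_isoLayer A B hA hB M hM₂ hM₃ hCM L α hL₂ hL₃ hα hαalg hαM c' hc' heval'
  have e : c = (c - c') + c' := by abel
  rw [e]
  exact M₁.add_mem hcc' hM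

end QuarticLayer

end Summit.KontsevichZagierPeriods.SymplecticScissors.RealOnePeriodRelations

end
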